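import Summits.ValiantsHypothesis.ValiantsHypothesis.Theorems.LacunarySymmetroidMatrixDescartesSeparatedWindow
import Summits.ValiantsHypothesis.ValiantsHypothesis.Theorems.LacunarySymmetroidMatrixDescartesCensusFatSectors
import Summits.ValiantsHypothesis.ValiantsHypothesis.Theorems.LacunarySymmetroidMatrixDescartesStubNegRoots

/-!
# `MatrixDescartes` — the LETTER-SEPARATED SECTOR: `Z₊ ≤ m` per hand-over of dominance, `Z ≤ 2Nm + 1`, and the
# crux's inequality on the sector at all fat formats

HONEST FRAMING.  Object-search cell `pub-symmetroid`, crux `Theses.LacunarySymmetroid.MatrixDescartes`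
(ledger item `stmt-ValiantsHypothesis-18050`, route `LacunarySymmetroid`; seat `val-sym-mdr-p2`, gen 12).  The
crux implies `VP ≠ VNP` by the route's assembly; NOTHING here is progress on it and nothing here is a claim
about `VP ≠ VNP`, `DoorA26` / `DoorA34` or the cell's registers.  This file assembles the structural window
law (`Separated.card_realRoots_window_le_of_separated`, file `…SeparatedWindow.lean`) into a SECTOR THEOREM with
MAGNITUDE hypotheses only — no symmetry, rank, commutation or definiteness is assumed of the letters:

* `not_isRoot_of_letter_dominance` — single-letter dominance at a point `x > 0`, in the same currency
  (`m!·m·E'(x)·(σ a x^(d a) + E'(x))^(m−1) < |det S a|·x^(m d a)`, `E'` = all other letters), excludes a zero.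
* `card_posRoots_le_of_separated` — **LETTER-SEPARATED SECTOR**: if the positive axis is covered by `N`
  structural windows (one per hand-over of dominance between two letters) and by points of single-letter
  dominance, then `Z₊ ≤ N·m`.  With the letters handing over one at a time along the exponent order, `N ≤ K − 1`
  and this is the matrix Descartes count `m(K−1)` — the «diagonal» column of the cell's Table S — now for
  arbitrary (indefinite, non-commuting) well-separated letters.
* `card_realRoots_le_of_separated` — the reflected pencil `S l ↦ (−1)^(d l) S l` has the same entry bounds and
  `|det|`s, so the same certificate bounds all real zeros: `Z ≤ 2Nm + 1` (tree `stub_negRoots`).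
* `separatedSector_mdr` — **the crux's inequality on the sector at all fat formats**: for all `c, q` there is
  `K₀` with `Z^q ≤ 2^(K⌊log₂K⌋)` for `K ≥ K₀`, `m ≤ 2^((⌊log₂K⌋+c)^c)` and every pencil with such a certificate of
  `N ≤ K` windows (tree `Census.fatFormat_absorb`).

WHAT THIS IS NOT.  The hypotheses demand a margin `exp(O(m log m))`·(conditioning) between consecutive
hand-overs — the matrix-level analogue of the ambiguity width `M = O(m log(mK))` of `HOME/…/GAP-LIFT.md` §3 (M2);
the cell's extremal rows violate them.  The theorem locates super-`m(K−1)` counts: they need overlapping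
hand-overs or ill-conditioned letters.  Sector bookkeeping beside the crux, not progress on it. [folklore]
-/

-- `Summit.ValiantsHypothesis.ValiantsHypothesis.…` repeats a component by the D-0017 layout
-- (single-conjunct summit), which the `dupNamespace` linter flags; the name is mandated.
set_option linter.dupNamespace false

namespace Summit.ValiantsHypothesis.ValiantsHypothesis.Theorems.LacunarySymmetroidMatrixDescartes.Separated

open Polynomial Complex Set Finset
open scoped BigOperators Matrix Real

/-! ## §9 The letter-separated sector: dominance regions, assembly, reflection, and the crux inequality -/

section Sector

variable {K m : ℕ} (d : Fin K → ℕ) (S : Fin K → Matrix (Fin m) (Fin m) ℝ) (σ : Fin K → ℝ)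

/-- **Single-letter dominance excludes zeros (structural form).**  With `|S l i j| ≤ σ l` and
`E'(x) = ∑_{l ≠ a} σ l·x^(d l)`: if `m!·m·E'(x)·(σ a·x^(d a) + E'(x))^(m−1) < |det S a|·x^(m·d a)` at a point
`x > 0`, then `det F(x) ≠ 0` (Leibniz bound against the single letter `a`). [folklore] -/
theorem not_isRoot_of_letter_dominance (hσ : ∀ l i j, |S l i j| ≤ σ l) (hσ0 : ∀ l, 0 ≤ σ l) (a : Fin K)
    {x : ℝ} (hx : 0 < x)
    (hdom : (m.factorial : ℝ) * (m * (∑ l ∈ Finset.univ.erase a, σ l * x ^ d l) *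
        (σ a * x ^ d a + ∑ l ∈ Finset.univ.erase a, σ l * x ^ d l) ^ (m - 1)) < |(S a).det| * x ^ (m * d a)) :
    ¬ (Matrix.det (∑ l, ((X : ℝ[X]) ^ d l) • (S l).map C)).IsRoot x := by
  intro hroot
  set z : ℂ := (x : ℂ) with hz
  have hzn : ‖z‖ = x := by rw [hz, Complex.norm_real, Real.norm_eq_abs, abs_of_pos hx]
  have hsplit : (∑ l, (z ^ d l) • (S l).map (algebraMap ℝ ℂ)) =
      (z ^ d a) • (S a).map (algebraMap ℝ ℂ) + ∑ l ∈ Finset.univ.erase a, (z ^ d l) • (S l).map (algebraMap ℝ ℂ) :=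
    (Finset.add_sum_erase _ _ (Finset.mem_univ a)).symm
  have hpert := norm_det_add_sub_det_le' ((z ^ d a) • (S a).map (algebraMap ℝ ℂ))
    (∑ l ∈ Finset.univ.erase a, (z ^ d l) • (S l).map (algebraMap ℝ ℂ))
    (μ := σ a * ‖z‖ ^ d a) (ε := ∑ l ∈ Finset.univ.erase a, σ l * ‖z‖ ^ d l)
    (mul_nonneg (hσ0 a) (pow_nonneg (norm_nonneg _) _))
    (Finset.sum_nonneg fun l _ => mul_nonneg (hσ0 l) (pow_nonneg (norm_nonneg _) _))
    (norm_entry_one_le d S σ hσ a z) (norm_entry_sum_le d S σ hσ _ z)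
  rw [← hsplit, hzn] at hpert
  -- the full determinant vanishes at `z = x`
  have hzero : Matrix.det (∑ l, (z ^ d l) • (S l).map (algebraMap ℝ ℂ)) = 0 := by
    rw [← RoucheWindow.eval_det_pencil, ← RoucheWindow.map_det_pencil, hz, RoucheWindow.eval_map_ofReal,
      hroot.eq_zero, Complex.ofReal_zero]
  rw [hzero, zero_sub, norm_neg, norm_det_one d S a z, hzn] at hpert
  linarith

/-- **LETTER-SEPARATED SECTOR: assembly.**  If the positive axis is covered by `N` structural windows
(`card_realRoots_window_le_of_separated`, letter pairs `a j, b j`, windows `(u j, v j)`) and by points of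
single-letter dominance (`not_isRoot_of_letter_dominance`), then `det F` has at most `N·m` distinct positive zeros;
with one window per hand-over between consecutive dominant letters, `N ≤ K − 1` and this is the matrix Descartes
count `m(K−1)` of the «diagonal» column — here for ARBITRARY real letters in the separated regime. [folklore] -/
theorem card_posRoots_le_of_separated (hσ : ∀ l i j, |S l i j| ≤ σ l) (hσ0 : ∀ l, 0 ≤ σ l) {N : ℕ}
    (a b : Fin N → Fin K) (hab : ∀ j, d (a j) < d (b j)) (u v : Fin N → ℝ) (hu : ∀ j, 0 < u j)
    (huv : ∀ j, u j < v j)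
    (hleft : ∀ j, (m.factorial : ℝ) * (m * (σ (b j) * u j ^ d (b j) +
        ∑ l ∈ (Finset.univ.erase (a j)).erase (b j), σ l * u j ^ d l) *
        (σ (a j) * u j ^ d (a j) + σ (b j) * u j ^ d (b j) +
          ∑ l ∈ (Finset.univ.erase (a j)).erase (b j), σ l * u j ^ d l) ^ (m - 1)) <
      |(S (a j)).det| * u j ^ (m * d (a j)))
    (hright : ∀ j, (m.factorial : ℝ) * (m * (σ (a j) * v j ^ d (a j) +
        ∑ l ∈ (Finset.univ.erase (a j)).erase (b j), σ l * v j ^ d l) *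
        (σ (a j) * v j ^ d (a j) + σ (b j) * v j ^ d (b j) +
          ∑ l ∈ (Finset.univ.erase (a j)).erase (b j), σ l * v j ^ d l) ^ (m - 1)) <
      |(S (b j)).det| * v j ^ (m * d (b j)))
    (hwin : ∀ j, ∀ x ∈ Set.Icc (u j) (v j),
      ((m : ℝ) + 1) ^ m * ((m.factorial : ℝ) * (m * (∑ l ∈ (Finset.univ.erase (a j)).erase (b j), σ l * x ^ d l) *
        (σ (a j) * x ^ d (a j) + σ (b j) * x ^ d (b j) +
          ∑ l ∈ (Finset.univ.erase (a j)).erase (b j), σ l * x ^ d l) ^ (m - 1))) <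
      max (|(S (a j)).det| * x ^ (m * d (a j))) (|(S (b j)).det| * x ^ (m * d (b j))))
    (hcover : ∀ x : ℝ, 0 < x → (∃ j, u j < x ∧ x < v j) ∨ ∃ l₀ : Fin K,
      (m.factorial : ℝ) * (m * (∑ l ∈ Finset.univ.erase l₀, σ l * x ^ d l) *
        (σ l₀ * x ^ d l₀ + ∑ l ∈ Finset.univ.erase l₀, σ l * x ^ d l) ^ (m - 1)) < |(S l₀).det| * x ^ (m * d l₀)) :
    ((Matrix.det (∑ l, ((X : ℝ[X]) ^ d l) • (S l).map C)).roots.toFinset.filter (fun t => 0 < t)).card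
      ≤ N * m := by
  classical
  set f : ℝ[X] := Matrix.det (∑ l, ((X : ℝ[X]) ^ d l) • (S l).map C) with hf_def
  by_cases hf0 : f = 0
  · rw [hf0, roots_zero, Multiset.toFinset_zero, Finset.filter_empty, Finset.card_empty]
    exact Nat.zero_le _
  have hsub : f.roots.toFinset.filter (fun t => 0 < t) ⊆
      (Finset.univ : Finset (Fin N)).biUnion
        (fun j => f.roots.toFinset.filter (fun x => u j < x ∧ x < v j)) := by
    intro x hx
    rw [Finset.mem_filter, Multiset.mem_toFinset, mem_roots hf0] at hx
    rcases hcover x hx.2 with ⟨j, hj⟩ | ⟨l₀, hl₀⟩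
    · rw [Finset.mem_biUnion]
      refine ⟨j, Finset.mem_univ j, ?_⟩
      rw [Finset.mem_filter, Multiset.mem_toFinset, mem_roots hf0]
      exact ⟨hx.1, hj⟩
    · exact absurd hx.1 (not_isRoot_of_letter_dominance d S σ hσ hσ0 l₀ hx.2 hl₀)
  calc (f.roots.toFinset.filter (fun t => 0 < t)).card
      ≤ ((Finset.univ : Finset (Fin N)).biUnion
          (fun j => f.roots.toFinset.filter (fun x => u j < x ∧ x < v j))).card := Finset.card_le_card hsub
    _ ≤ ∑ j : Fin N, (f.roots.toFinset.filter (fun x => u j < x ∧ x < v j)).card := Finset.card_biUnion_le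
    _ ≤ ∑ _j : Fin N, m :=
        Finset.sum_le_sum fun j _ => card_realRoots_window_le_of_separated d S σ hσ hσ0 (a j) (b j) (hab j)
          (hu j) (huv j) (hleft j) (hright j) (hwin j)
    _ = N * m := by rw [Finset.sum_const, Finset.card_univ, Fintype.card_fin, smul_eq_mul]

/-- The reflected pencil `S l ↦ (−1)^(d l) S l` has the same entry bounds and the same `|det|`s, so the separation
certificate of `F(X)` is also one for `F(−X)`: ALL real zeros are bounded, `Z ≤ 2·N·m + 1`. [folklore] -/
theorem card_realRoots_le_of_separated (hσ : ∀ l i j, |S l i j| ≤ σ l) (hσ0 : ∀ l, 0 ≤ σ l) {N : ℕ}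
    (a b : Fin N → Fin K) (hab : ∀ j, d (a j) < d (b j)) (u v : Fin N → ℝ) (hu : ∀ j, 0 < u j)
    (huv : ∀ j, u j < v j)
    (hleft : ∀ j, (m.factorial : ℝ) * (m * (σ (b j) * u j ^ d (b j) +
        ∑ l ∈ (Finset.univ.erase (a j)).erase (b j), σ l * u j ^ d l) *
        (σ (a j) * u j ^ d (a j) + σ (b j) * u j ^ d (b j) +
          ∑ l ∈ (Finset.univ.erase (a j)).erase (b j), σ l * u j ^ d l) ^ (m - 1)) <
      |(S (a j)).det| * u j ^ (m * d (a j)))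
    (hright : ∀ j, (m.factorial : ℝ) * (m * (σ (a j) * v j ^ d (a j) +
        ∑ l ∈ (Finset.univ.erase (a j)).erase (b j), σ l * v j ^ d l) *
        (σ (a j) * v j ^ d (a j) + σ (b j) * v j ^ d (b j) +
          ∑ l ∈ (Finset.univ.erase (a j)).erase (b j), σ l * v j ^ d l) ^ (m - 1)) <
      |(S (b j)).det| * v j ^ (m * d (b j)))
    (hwin : ∀ j, ∀ x ∈ Set.Icc (u j) (v j),
      ((m : ℝ) + 1) ^ m * ((m.factorial : ℝ) * (m * (∑ l ∈ (Finset.univ.erase (a j)).erase (b j), σ l * x ^ d l) *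
        (σ (a j) * x ^ d (a j) + σ (b j) * x ^ d (b j) +
          ∑ l ∈ (Finset.univ.erase (a j)).erase (b j), σ l * x ^ d l) ^ (m - 1))) <
      max (|(S (a j)).det| * x ^ (m * d (a j))) (|(S (b j)).det| * x ^ (m * d (b j))))
    (hcover : ∀ x : ℝ, 0 < x → (∃ j, u j < x ∧ x < v j) ∨ ∃ l₀ : Fin K,
      (m.factorial : ℝ) * (m * (∑ l ∈ Finset.univ.erase l₀, σ l * x ^ d l) *
        (σ l₀ * x ^ d l₀ + ∑ l ∈ Finset.univ.erase l₀, σ l * x ^ d l) ^ (m - 1)) < |(S l₀).det| * x ^ (m * d l₀)) :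
    (Matrix.det (∑ l, ((X : ℝ[X]) ^ d l) • (S l).map C)).roots.toFinset.card ≤ 2 * (N * m) + 1 := by
  have hS' : ∀ l i j, |(((-1 : ℝ) ^ d l) • S l) i j| ≤ σ l := by
    intro l i j
    rw [Matrix.smul_apply, smul_eq_mul, abs_mul, abs_pow, abs_neg, abs_one, one_pow, one_mul]
    exact hσ l i j
  have hdet' : ∀ l, |(((-1 : ℝ) ^ d l) • S l).det| = |(S l).det| := by
    intro l
    rw [Matrix.det_smul, abs_mul, abs_pow, abs_pow, abs_neg, abs_one, one_pow, one_pow, one_mul]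
  have h1 := card_posRoots_le_of_separated d S σ hσ hσ0 a b hab u v hu huv hleft hright hwin hcover
  have h2 := card_posRoots_le_of_separated d (fun l => ((-1 : ℝ) ^ d l) • S l) σ hS' hσ0 a b hab u v hu huv
    (fun j => by rw [hdet']; exact hleft j) (fun j => by rw [hdet']; exact hright j)
    (fun j x hx => by rw [hdet', hdet']; exact hwin j x hx)
    (fun x hx => by
      rcases hcover x hx with h | ⟨l₀, hl₀⟩
      · exact Or.inl h
      · exact Or.inr ⟨l₀, by rw [hdet']; exact hl₀⟩)
  have h3 := stub_negRoots K m d S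
  omega

/-- **The crux's inequality on the letter-separated sector, at all fat formats.**  For all `c, q` there is
`K₀` such that for `K ≥ K₀`, `m ≤ 2^((⌊log₂K⌋+c)^c)` and EVERY real `m × m` lacunary pencil (symmetric or not)
admitting a separation certificate as above with `N ≤ K` windows, `Z^q ≤ 2^(K⌊log₂K⌋)` — the inequality of
`MatrixDescartes` on this sector (`Z ≤ 2Km + 1`; tree `Census.fatFormat_absorb`).  A SECTOR theorem: it says
nothing about pencils with overlapping hand-overs, where all the difficulty of the crux lies. [folklore] -/
theorem separatedSector_mdr (c q : ℕ) : ∃ K₀ : ℕ, ∀ K m : ℕ, K₀ ≤ K → m ≤ 2 ^ ((Nat.log 2 K + c) ^ c) →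
    ∀ (d : Fin K → ℕ) (S : Fin K → Matrix (Fin m) (Fin m) ℝ) (σ : Fin K → ℝ),
      (∀ l i j, |S l i j| ≤ σ l) → (∀ l, 0 ≤ σ l) →
      ∀ (N : ℕ) (a b : Fin N → Fin K) (u v : Fin N → ℝ), N ≤ K → (∀ j, d (a j) < d (b j)) →
      (∀ j, 0 < u j) → (∀ j, u j < v j) →
      (∀ j, (m.factorial : ℝ) * (m * (σ (b j) * u j ^ d (b j) +
          ∑ l ∈ (Finset.univ.erase (a j)).erase (b j), σ l * u j ^ d l) *
          (σ (a j) * u j ^ d (a j) + σ (b j) * u j ^ d (b j) +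
            ∑ l ∈ (Finset.univ.erase (a j)).erase (b j), σ l * u j ^ d l) ^ (m - 1)) <
        |(S (a j)).det| * u j ^ (m * d (a j))) →
      (∀ j, (m.factorial : ℝ) * (m * (σ (a j) * v j ^ d (a j) +
          ∑ l ∈ (Finset.univ.erase (a j)).erase (b j), σ l * v j ^ d l) *
          (σ (a j) * v j ^ d (a j) + σ (b j) * v j ^ d (b j) +
            ∑ l ∈ (Finset.univ.erase (a j)).erase (b j), σ l * v j ^ d l) ^ (m - 1)) <
        |(S (b j)).det| * v j ^ (m * d (b j))) →
      (∀ j, ∀ x ∈ Set.Icc (u j) (v j),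
        ((m : ℝ) + 1) ^ m * ((m.factorial : ℝ) *
          (m * (∑ l ∈ (Finset.univ.erase (a j)).erase (b j), σ l * x ^ d l) *
          (σ (a j) * x ^ d (a j) + σ (b j) * x ^ d (b j) +
            ∑ l ∈ (Finset.univ.erase (a j)).erase (b j), σ l * x ^ d l) ^ (m - 1))) <
        max (|(S (a j)).det| * x ^ (m * d (a j))) (|(S (b j)).det| * x ^ (m * d (b j)))) →
      (∀ x : ℝ, 0 < x → (∃ j, u j < x ∧ x < v j) ∨ ∃ l₀ : Fin K,
        (m.factorial : ℝ) * (m * (∑ l ∈ Finset.univ.erase l₀, σ l * x ^ d l) *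
          (σ l₀ * x ^ d l₀ + ∑ l ∈ Finset.univ.erase l₀, σ l * x ^ d l) ^ (m - 1)) <
        |(S l₀).det| * x ^ (m * d l₀)) →
      (Matrix.det (∑ l, ((X : ℝ[X]) ^ d l) • (S l).map C)).roots.toFinset.card ^ q ≤ 2 ^ (K * Nat.log 2 K) := by
  obtain ⟨K₀, hK₀⟩ := Census.fatFormat_absorb 2 c q
  refine ⟨K₀, fun K m hK hm d S σ hσ hσ0 N a b u v hN hab hu huv hleft hright hwin hcover => hK₀ K m _ hK hm ?_⟩
  have h := card_realRoots_le_of_separated d S σ hσ hσ0 a b hab u v hu huv hleft hright hwin hcover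
  have h2 : 2 * (N * m) + 1 ≤ 2 ^ 2 * (m + 1) * (K + 1) := by
    have : N * m ≤ K * m := Nat.mul_le_mul_right m hN
    nlinarith
  exact h.trans h2

end Sector

end Summit.ValiantsHypothesis.ValiantsHypothesis.Theorems.LacunarySymmetroidMatrixDescartes.Separated
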